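import Literature.AnabelianGeometry.SemiGraphs.FiniteEtaleCoveringDictionary
import Literature.AnabelianGeometry.SemiGraphs.SubdivisionLemmas

/-!
# Components of the preimage of a sub-semi-graph: two small structural lemmas — PROOFS

Mochizuki, *Semi-graphs of anabelioids*, Publ. RIMS **42** (2006), §1 p. 12 (sub-semi-graphs) and §2
p. 30 (proof of Cor. 2.7 (i): "a connected component `ℋ″` of `ℋ′`").
[cite: MochizukiSemiAnbd2006, Cor. 2.7(i) p.30]

For the pigeonhole step of the Cor. 2.7 (i) reduction over the UNTIED dictionary fact (D3)
(`covering_subgraphComponents_doubleCosets`, dictionary v4 — rulings τ2/ψ2 of the abc-iut cell):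

* `Subgraph.inclusion` — the inclusion morphism of sub-semi-graphs `H ≤ K`;
* `Subgraph.isConnected_of_edges_subset` — adding to a connected sub-semi-graph edges all of whose
  branches abut to its vertices keeps it connected;
* `Hom.IsPreimageComponent.eq_of_verts_eq` — two components (`Hom.IsPreimageComponent`, maximal
  connected sub-GRAPHS of the preimage) with the same vertex set coincide (maximality).

Theorems only (plus the inclusion morphism, a definition-free `Hom` term); no `sorry`.
-/

namespace Literature.AnabelianGeometry.SemiGraphs

open CategoryTheory

universe v₁ u₁ u

namespace SemiGraph

variable {G : SemiGraph.{u}}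

/-- The coincidence map of a sub-semi-graph at a branch abutting (in `G`) to a vertex of the
sub-semi-graph. [cite: MochizukiSemiAnbd2006, §1 p.12] -/
theorem Subgraph.toSemiGraph_abuts_of_mem (K : G.Subgraph) {b : G.Branch} (hb : G.edgeOf b ∈ K.edges)
    {u : G.Vertex} (hbu : G.abuts b = some u) (hu : u ∈ K.verts) :
    K.toSemiGraph.abuts ⟨b, hb⟩ = some ⟨u, hu⟩ := by
  change (G.abuts b).pbind _ = _
  simp only [hbu, Option.pbind_some]
  exact dif_pos hu

/-- In a sub-semi-graph which is a graph, every branch of one of its edges abuts (in `G`) to one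
of its vertices. [cite: MochizukiSemiAnbd2006, §1 p.12] -/
theorem Subgraph.exists_abuts_of_isGraph (K : G.Subgraph) (hK : K.toSemiGraph.IsGraph)
    {b : G.Branch} (hb : G.edgeOf b ∈ K.edges) : ∃ u ∈ K.verts, G.abuts b = some u := by
  obtain ⟨u, hu⟩ := Option.isSome_iff_exists.mp (hK.abuts_isSome ⟨b, hb⟩)
  exact ⟨u.1, u.2, K.ι.abuts_branchMap ⟨b, hb⟩ u hu⟩

/-- The inclusion morphism of sub-semi-graphs `H ≤ K`. [cite: MochizukiSemiAnbd2006, §1 p.12] -/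
theorem Subgraph.nonempty_hom_of_subset {H K : G.Subgraph} (hv : H.verts ⊆ K.verts)
    (he : H.edges ⊆ K.edges) :
    ∃ ψ : H.toSemiGraph ⟶ K.toSemiGraph, (∀ v, (ψ.vertexMap v).1 = v.1) ∧
      (∀ e, (ψ.edgeMap e).1 = e.1) ∧ ∀ b, (ψ.branchMap b).1 = b.1 := by
  refine ⟨{ vertexMap := fun v => ⟨v.1, hv v.2⟩
            edgeMap := fun e => ⟨e.1, he e.2⟩
            branchMap := fun b => ⟨b.1, he b.2⟩
            edgeOf_branchMap := fun _ => rfl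
            branchMap_injOn := fun _ _ _ h => Subtype.ext (Subtype.mk.inj h)
            abuts_branchMap := fun b v h =>
              K.toSemiGraph_abuts_of_mem (he b.2) (H.ι.abuts_branchMap b v h) (hv v.2) },
    fun _ => rfl, fun _ => rfl, fun _ => rfl⟩

/-- Adding edges to a connected sub-semi-graph keeps it connected, provided every branch of the
new edges abuts to a vertex of the sub-semi-graph. [cite: MochizukiSemiAnbd2006, §1 p.12] -/
theorem Subgraph.isConnected_of_edges_subset {H K : G.Subgraph} (hH : H.toSemiGraph.IsConnected)
    (hv : K.verts = H.verts) (he : H.edges ⊆ K.edges)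
    (habut : ∀ b : G.Branch, G.edgeOf b ∈ K.edges → ∃ u ∈ K.verts, G.abuts b = some u) :
    K.toSemiGraph.IsConnected := by
  obtain ⟨ψ, hψv, -, -⟩ := Subgraph.nonempty_hom_of_subset (hv ▸ subset_rfl : H.verts ⊆ K.verts) he
  let f : H.toSemiGraph.Node → K.toSemiGraph.Node :=
    Sum.map ψ.vertexMap (Sum.map ψ.edgeMap ψ.branchMap)
  have hf : ∀ x y, H.toSemiGraph.subdivision.Reachable x y →
      K.toSemiGraph.subdivision.Reachable (f x) (f y) := by
    intro x y h
    exact h.map { toFun := f, map_rel' := fun h => subdivision_adj_map ψ h }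
  have hconn := hH.connected
  -- every node of `K` is reachable from the image of a node of `H`
  have hreach : ∀ x : K.toSemiGraph.Node, ∃ y : H.toSemiGraph.Node,
      K.toSemiGraph.subdivision.Reachable (f y) x := by
    have hvert : ∀ u : K.toSemiGraph.Vertex, ∃ y : H.toSemiGraph.Node, f y = Sum.inl u := by
      intro u
      refine ⟨Sum.inl ⟨u.1, hv ▸ u.2⟩, ?_⟩
      change Sum.inl (ψ.vertexMap _) = _
      congr 1
      exact Subtype.ext (hψv _)
    have hbranch : ∀ b : K.toSemiGraph.Branch, ∃ y : H.toSemiGraph.Node,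
        K.toSemiGraph.subdivision.Reachable (f y) (Sum.inr (Sum.inr b)) := by
      intro b
      obtain ⟨u, hu, hbu⟩ := habut b.1 b.2
      obtain ⟨y, hy⟩ := hvert ⟨u, hu⟩
      refine ⟨y, ?_⟩
      rw [hy]
      exact (K.toSemiGraph.subdivision_reachable_branch_vertex
        (K.toSemiGraph_abuts_of_mem b.2 hbu hu)).symm
    rintro (u | e | b)
    · obtain ⟨y, hy⟩ := hvert u
      exact ⟨y, hy ▸ SimpleGraph.Reachable.refl _⟩
    · obtain ⟨b₁, -, -, h₁, -, -⟩ := K.toSemiGraph.two_branches e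
      obtain ⟨y, hy⟩ := hbranch b₁
      refine ⟨y, hy.trans ?_⟩
      rw [← h₁]
      exact (K.toSemiGraph.subdivision_reachable_edge_branch b₁).symm
    · exact hbranch b
  obtain ⟨x₀⟩ := hconn.nonempty
  haveI : Nonempty K.toSemiGraph.Node := ⟨f x₀⟩
  refine ⟨SimpleGraph.Connected.mk fun x y => ?_⟩
  obtain ⟨a, ha⟩ := hreach x
  obtain ⟨b, hb⟩ := hreach y
  exact ha.symm.trans ((hf a b (hconn.preconnected a b)).trans hb)

end SemiGraph

namespace SemiGraphOfAnabelioids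

variable {𝒢 𝒢' : SemiGraphOfAnabelioids.{v₁, u₁, u}}

/-- **Components with the same vertices coincide.**  Two components of the preimage of `ℍ`
(`Hom.IsPreimageComponent`: maximal connected sub-graphs of `φ⁻¹(ℍ)` with a vertex) having the same
vertex set are equal — by maximality, since the union of their edge sets on the common vertex set is
again a connected sub-semi-graph of the preimage. [cite: MochizukiSemiAnbd2006, Cor. 2.7(i) p.30] -/
theorem Hom.IsPreimageComponent.eq_of_verts_eq {φ : Hom 𝒢' 𝒢} {H : 𝒢.graph.Subgraph}
    {K K' : 𝒢'.graph.Subgraph} (hK : φ.IsPreimageComponent H K)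
    (hK' : φ.IsPreimageComponent H K') (hverts : K.verts = K'.verts) : K = K' := by
  -- the union of the two edge sets on the common vertex set
  let K'' : 𝒢'.graph.Subgraph := ⟨K'.verts, K'.edges ∪ K.edges⟩
  have habut : ∀ b : 𝒢'.graph.Branch, 𝒢'.graph.edgeOf b ∈ K''.edges →
      ∃ u ∈ K''.verts, 𝒢'.graph.abuts b = some u := by
    rintro b (hb | hb)
    · exact K'.exists_abuts_of_isGraph hK'.2.1 hb
    · obtain ⟨u, hu, hbu⟩ := K.exists_abuts_of_isGraph hK.2.1 hb
      exact ⟨u, hverts ▸ hu, hbu⟩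
  have hconn : K''.toSemiGraph.IsConnected :=
    SemiGraph.Subgraph.isConnected_of_edges_subset hK'.1 rfl Set.subset_union_left habut
  have hmax := hK'.2.2.2.2.2 K'' hconn hK'.2.2.2.1
    (Set.union_subset hK'.2.2.2.2.1 hK.2.2.2.2.1) subset_rfl Set.subset_union_left
  -- hence `K.edges ⊆ K'.edges`; by symmetry the edge sets agree
  have h1 : K.edges ⊆ K'.edges := by
    have : K''.edges = K'.edges := congrArg SemiGraph.Subgraph.edges hmax
    exact fun e he => this ▸ (Set.mem_union_right _ he)
  let K₃ : 𝒢'.graph.Subgraph := ⟨K.verts, K.edges ∪ K'.edges⟩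
  have habut' : ∀ b : 𝒢'.graph.Branch, 𝒢'.graph.edgeOf b ∈ K₃.edges →
      ∃ u ∈ K₃.verts, 𝒢'.graph.abuts b = some u := by
    rintro b (hb | hb)
    · exact K.exists_abuts_of_isGraph hK.2.1 hb
    · obtain ⟨u, hu, hbu⟩ := K'.exists_abuts_of_isGraph hK'.2.1 hb
      exact ⟨u, hverts.symm ▸ hu, hbu⟩
  have hconn' : K₃.toSemiGraph.IsConnected :=
    SemiGraph.Subgraph.isConnected_of_edges_subset hK.1 rfl Set.subset_union_left habut'
  have hmax' := hK.2.2.2.2.2 K₃ hconn' hK.2.2.2.1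
    (Set.union_subset hK.2.2.2.2.1 hK'.2.2.2.2.1) subset_rfl Set.subset_union_left
  have h2 : K'.edges ⊆ K.edges := by
    have : K₃.edges = K.edges := congrArg SemiGraph.Subgraph.edges hmax'
    exact fun e he => this ▸ (Set.mem_union_right _ he)
  exact SemiGraph.Subgraph.ext hverts (Set.Subset.antisymm h1 h2)

end SemiGraphOfAnabelioids

end Literature.AnabelianGeometry.SemiGraphs
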